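import Mathlib.RingTheory.MvPolynomial.Homogeneous
import Mathlib.RingTheory.Nullstellensatz
import Mathlib.LinearAlgebra.Matrix.NonsingularInverse
import Mathlib.Algebra.Order.Antidiag.Finsupp
import Literature.NumberTheory.Automorphic.ZariskiAffineSpace
import HarnessLib

/-!
# The main theorem of elimination theory on `k`-points: projective space is complete
(trunk T-AUTOMORPHIC, G25 AutomorphicL; Springer 6.1, used for Borel's fixed point theorem 6.2.6)

In the concrete `k`-points vocabulary of `ZariskiAffineSpace.lean` (Zariski topology
`zariskiTopologyPi σ k` on affine space `σ → k`) we prove the **main theorem of elimination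
theory** (Springer, *Linear Algebraic Groups*, 2nd ed., 6.1.1–6.1.3: *projective varieties are
complete*, i.e. the projection `ℙⁿ × Y → Y` is closed), in the following elementary form over an
algebraically closed field:

* `isClosed_setOf_exists_common_zero` — for a finite family `f j ∈ k[y][X₀, …, Xₙ]` of
  polynomials homogeneous in the `X`-variables (degrees `d j`), the set
  `{y ∈ kᵐ | the f j (y, ·) have a common zero x ≠ 0 in kⁿ⁺¹}` is Zariski closed in `kᵐ`.

Every closed subset of `ℙⁿ × kᵐ` is cut out by such a family, so this is the statement that the
projection `ℙⁿ(k) × kᵐ → kᵐ` is a closed map on `k`-points. The proof is the classical one by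
linear algebra (e.g. Shafarevich, *Basic Algebraic Geometry* I.5.2, Thm 3; Mumford, *Red Book*
I.9), with no scheme theory:

1. `exists_ne_zero_common_zero_iff` — **projective Nullstellensatz**: the `f j (y, ·)` have a
   common zero `x ≠ 0` iff for every `D` some monomial of degree `D` is *not* in the ideal `I_y`
   they generate (from Mathlib's affine Nullstellensatz
   `MvPolynomial.vanishingIdeal_zeroLocus_eq_radical`: no common zero off `0` forces
   `Xᵢ ∈ √I_y`, hence `(X₀, …, Xₙ)^D ⊆ I_y` for large `D` by pigeonhole);
2. `forall_monomial_mem_iff_surjective` — for homogeneous generators, "all monomials of degree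
   `D` lie in `I_y`" is the surjectivity of the linear *multiplication map*
   `⊕ⱼ k[X]_{D - d j} → k[X]_D`, `(gⱼ) ↦ ∑ gⱼ fⱼ(y, ·)`, whose matrix `sylvesterMatrix` in the
   monomial bases has entries polynomial in `y` (`sylvesterMatrix_specialize`);
3. `mulVec_surjective_iff_exists_det_ne_zero` — a matrix over a field defines a surjective map iff
   some maximal minor is non-zero; so non-surjectivity is the vanishing of all maximal minors, a
   closed condition in `y`, and the set in question is the intersection over `D` of these closed
   sets.

## Mathlib

`MvPolynomial.IsHomogeneous`, `homogeneousComponent`, `MvPolynomial.vanishingIdeal_zeroLocus_eq_radical`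
(Nullstellensatz), `Finset.finsuppAntidiag` (exponents of given degree), `Matrix.mulVec`,
`Matrix.mulVec_surjective_iff_isUnit`, `Matrix.linearIndependent_cols_iff_isUnit`,
`exists_linearIndependent`, `RingHom.map_det`. Mathlib has the scheme-theoretic statement that
`Proj` is proper in special cases but no elimination theorem on naive points (searched
`elimination`, `resultant` — only the two-polynomial resultant —, `proper` + `Proj`).

## References

* T. A. Springer, *Linear Algebraic Groups*, 2nd ed., Birkhäuser (1998), 6.1.1–6.1.3.
* I. R. Shafarevich, *Basic Algebraic Geometry 1*, 3rd ed., Springer (2013), I.5.2, Thm 1.10–1.11.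
-/

namespace Literature.NumberTheory.Automorphic

open MvPolynomial

variable {k : Type*} [Field k] {ι : Type*} [Fintype ι] [DecidableEq ι]

/-! ### Monomials of a given degree; the projective Nullstellensatz -/

section Nullstellensatz

omit [Fintype ι] [DecidableEq ι] in
/-- Every element of an ideal of `k[X]` vanishes on the common zeros of a generating family.
[folklore] -/
theorem eval_eq_zero_of_mem_span {m : ℕ} {g : Fin m → MvPolynomial ι k} {x : ι → k}
    (hx : ∀ j, eval x (g j) = 0) {p : MvPolynomial ι k} (hp : p ∈ Ideal.span (Set.range g)) :
    eval x p = 0 := by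
  rw [← RingHom.mem_ker]
  refine (Ideal.span_le.2 ?_) hp
  rintro _ ⟨j, rfl⟩
  exact (RingHom.mem_ker).2 (hx j)

omit [DecidableEq ι] in
/-- A monomial of degree `≥ #ι · E` has an exponent `≥ E` (pigeonhole). [folklore] -/
theorem exists_le_of_degree_ge {E : ℕ} {s : ι →₀ ℕ} (hs : Fintype.card ι * E ≤ s.degree)
    [Nonempty ι] : ∃ i, E ≤ s i := by
  by_contra h
  push Not at h
  have : s.degree < Fintype.card ι * E := by
    rw [Finsupp.degree_eq_sum]
    calc ∑ i, s i < ∑ _i : ι, E := Finset.sum_lt_sum_of_nonempty Finset.univ_nonempty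
            (fun i _ => h i)
      _ = Fintype.card ι * E := by simp
  omega

/-- **Projective Nullstellensatz, the key direction**: if the homogeneous (or any) polynomials
`g j` have no common zero other than `0`, then for some `D` every monomial of degree `D` lies in
the ideal they generate. [folklore] -/
theorem exists_forall_monomial_mem_of_forall_zero [IsAlgClosed k] {m : ℕ}
    {g : Fin m → MvPolynomial ι k} (h : ∀ x : ι → k, (∀ j, eval x (g j) = 0) → x = 0) :
    ∃ D : ℕ, ∀ s : ι →₀ ℕ, s.degree = D → monomial s (1 : k) ∈ Ideal.span (Set.range g) := by
  classical
  set I : Ideal (MvPolynomial ι k) := Ideal.span (Set.range g) with hI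
  -- each `X i` vanishes on the zero locus `⊆ {0}` of `I`, hence `X i ^ e ∈ I`
  have hX : ∀ i : ι, ∃ e : ℕ, 0 < e ∧ (X i : MvPolynomial ι k) ^ e ∈ I := by
    intro i
    have hmem : (X i : MvPolynomial ι k) ∈ vanishingIdeal k (zeroLocus k I) := by
      rw [mem_vanishingIdeal_iff]
      intro x hx
      have hx0 : x = 0 := h x fun j => by
        rw [mem_zeroLocus_iff] at hx
        have := hx (g j) (Ideal.subset_span ⟨j, rfl⟩)
        rwa [aeval_eq_eval] at this
      simp [hx0]
    rw [vanishingIdeal_zeroLocus_eq_radical] at hmem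
    obtain ⟨e, he⟩ := hmem
    refine ⟨e + 1, Nat.succ_pos e, ?_⟩
    rw [pow_succ]
    exact I.mul_mem_right _ he
  choose e he0 he using hX
  rcases isEmpty_or_nonempty ι with hι | hι
  · -- no variables: the only monomial is `1`, and `x = 0` is the only point; then `h` is
    -- vacuous but so is the conclusion unless `1 ∈ I`; we use `D = 1`: no monomial of degree 1
    refine ⟨1, fun s hs => ?_⟩
    exfalso
    rw [Finsupp.degree_eq_sum] at hs
    simp at hs
  set E := Finset.univ.sup e with hE
  have hEpos : 0 < E := by
    obtain ⟨i⟩ := hι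
    exact lt_of_lt_of_le (he0 i) (Finset.le_sup (Finset.mem_univ i))
  refine ⟨Fintype.card ι * E, fun s hs => ?_⟩
  obtain ⟨i, hi⟩ := exists_le_of_degree_ge hs.ge
  -- `X^s = X^(s - E eᵢ) · X i ^ E` and `X i ^ E ∈ I`
  have hXiE : (X i : MvPolynomial ι k) ^ E ∈ I := by
    have hle : e i ≤ E := Finset.le_sup (Finset.mem_univ i)
    rw [← Nat.sub_add_cancel hle, pow_add]
    exact I.mul_mem_left _ (he i)
  have hs' : s = (s - Finsupp.single i E) + Finsupp.single i E := by
    ext j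
    rw [Finsupp.add_apply, Finsupp.tsub_apply, Finsupp.single_apply]
    split_ifs with hij
    · subst hij; omega
    · omega
  have e1 : monomial s (1 : k) =
      monomial (s - Finsupp.single i E) (1 : k) * (X i : MvPolynomial ι k) ^ E := by
    rw [X_pow_eq_monomial, monomial_mul, mul_one, ← hs']
  rw [e1]
  exact I.mul_mem_left _ hXiE

/-- **Projective Nullstellensatz** for a finite family `g j ∈ k[X]` over an algebraically closed
field: the `g j` have a common zero `x ≠ 0` iff for every `D` some monomial of degree `D` does
not lie in the ideal `(g j)`. [folklore] -/
theorem exists_ne_zero_common_zero_iff [IsAlgClosed k] {m : ℕ} {g : Fin m → MvPolynomial ι k} :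
    (∃ x : ι → k, x ≠ 0 ∧ ∀ j, eval x (g j) = 0) ↔
      ∀ D : ℕ, ¬ ∀ s : ι →₀ ℕ, s.degree = D → monomial s (1 : k) ∈ Ideal.span (Set.range g) := by
  constructor
  · rintro ⟨x, hx0, hx⟩ D hD
    obtain ⟨i, hi⟩ : ∃ i, x i ≠ 0 := by
      by_contra h
      push Not at h
      exact hx0 (funext h)
    have hmem := hD (Finsupp.single i D) (by simp [Finsupp.degree_single])
    have h0 := eval_eq_zero_of_mem_span hx hmem
    simp only [eval_monomial, one_mul, Finsupp.prod_single_index, pow_zero] at h0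
    exact pow_ne_zero D hi h0
  · intro h
    by_contra hne
    push Not at hne
    have h' : ∀ x : ι → k, (∀ j, eval x (g j) = 0) → x = 0 := fun x hx => by
      by_contra hx0
      exact (hne x hx0) |>.elim fun j hj => hj (hx j)
    obtain ⟨D, hD⟩ := exists_forall_monomial_mem_of_forall_zero h'
    exact h D hD

end Nullstellensatz

/-! ### Homogeneous ideals in a fixed degree: the multiplication (Sylvester) map -/

section Sylvester

variable {m : ℕ}

omit [Fintype ι] [DecidableEq ι] in
/-- The degree-`D` component of `c * g` for `g` homogeneous of degree `d`, as a sum over the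
homogeneous components of `c`. [folklore] -/
theorem homogeneousComponent_mul_eq_sum {g : MvPolynomial ι k} (c : MvPolynomial ι k) {d : ℕ}
    (hg : g.IsHomogeneous d) (D : ℕ) :
    homogeneousComponent D (c * g) = ∑ a ∈ Finset.range (c.totalDegree + 1),
      if a + d = D then homogeneousComponent a c * g else 0 := by
  classical
  conv_lhs => rw [← sum_homogeneousComponent c, Finset.sum_mul]
  rw [map_sum]
  refine Finset.sum_congr rfl fun a _ => ?_
  rw [homogeneousComponent_of_mem ((homogeneousComponent_isHomogeneous a c).mul hg)]
  by_cases h : a + d = D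
  · rw [if_pos h, if_pos h.symm]
  · rw [if_neg h, if_neg (Ne.symm h)]

omit [Fintype ι] [DecidableEq ι] in
/-- The degree-`D` component of `c * g` for `g` homogeneous of degree `d ≤ D` is `c_{D-d} g`.
[folklore] -/
theorem homogeneousComponent_mul_of_isHomogeneous {g : MvPolynomial ι k} (c : MvPolynomial ι k)
    {d D : ℕ} (hg : g.IsHomogeneous d) (hdD : d ≤ D) :
    homogeneousComponent D (c * g) = homogeneousComponent (D - d) c * g := by
  classical
  rw [homogeneousComponent_mul_eq_sum c hg D]
  have e : ∀ a, (a + d = D) ↔ (D - d = a) := fun a => by omega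
  simp_rw [e]
  rw [Finset.sum_ite_eq]
  by_cases hmem : D - d ∈ Finset.range (c.totalDegree + 1)
  · rw [if_pos hmem]
  · rw [if_neg hmem, homogeneousComponent_eq_zero]
    · rw [zero_mul]
    · rw [Finset.mem_range, not_lt] at hmem
      omega

omit [Fintype ι] [DecidableEq ι] in
/-- The degree-`D` component of `c * g` for `g` homogeneous of degree `d > D` vanishes.
[folklore] -/
theorem homogeneousComponent_mul_of_lt {g : MvPolynomial ι k} (c : MvPolynomial ι k)
    {d D : ℕ} (hg : g.IsHomogeneous d) (hDd : D < d) : homogeneousComponent D (c * g) = 0 := by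
  rw [homogeneousComponent_mul_eq_sum c hg D]
  refine Finset.sum_eq_zero fun a _ => ?_
  rw [if_neg]
  omega

omit [Fintype ι] [DecidableEq ι] in
/-- **Membership of a homogeneous polynomial in a homogeneous ideal is decided in its degree**:
if `p` is homogeneous of degree `D` and lies in the ideal generated by homogeneous `g j` of
degrees `d j`, then `p = ∑ c j * g j` with `c j` homogeneous of degree `D - d j` and `c j = 0`
when `d j > D`. [folklore] -/
theorem exists_homogeneous_combination {g : Fin m → MvPolynomial ι k} {d : Fin m → ℕ}
    (hg : ∀ j, (g j).IsHomogeneous (d j)) {p : MvPolynomial ι k} {D : ℕ} (hp : p.IsHomogeneous D)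
    (hmem : p ∈ Ideal.span (Set.range g)) :
    ∃ c : Fin m → MvPolynomial ι k, (∀ j, (c j).IsHomogeneous (D - d j)) ∧
      (∀ j, D < d j → c j = 0) ∧ p = ∑ j, c j * g j := by
  classical
  obtain ⟨c, hc⟩ := Ideal.mem_span_range_iff_exists_fun.1 hmem
  refine ⟨fun j => if d j ≤ D then homogeneousComponent (D - d j) (c j) else 0, fun j => ?_,
    fun j hj => by simp [not_le.2 hj], ?_⟩
  · dsimp only
    by_cases hjD : d j ≤ D
    · rw [if_pos hjD]; exact homogeneousComponent_isHomogeneous _ _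
    · rw [if_neg hjD]; exact isHomogeneous_zero _ _ _
  · calc p = homogeneousComponent D p := (homogeneousComponent_eq_self hp).symm
      _ = ∑ j, homogeneousComponent D (c j * g j) := by rw [← hc, map_sum]
      _ = ∑ j, (if d j ≤ D then homogeneousComponent (D - d j) (c j) else 0) * g j := by
          refine Finset.sum_congr rfl fun j _ => ?_
          by_cases hjD : d j ≤ D
          · rw [if_pos hjD]; exact homogeneousComponent_mul_of_isHomogeneous (c j) (hg j) hjD
          · rw [if_neg hjD, zero_mul]
            exact homogeneousComponent_mul_of_lt (c j) (hg j) (not_le.1 hjD)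

/-- Exponent vectors of degree `D` (a finite type: Mathlib `Finset.finsuppAntidiag`). [folklore] -/
abbrev Exps (ι : Type*) (D : ℕ) : Type _ :=
  {s : ι →₀ ℕ // s.degree = D}

/-- Exponent vectors of degree `D` are those in `finsuppAntidiag univ D`. [folklore] -/
theorem mem_finsuppAntidiag_univ_iff {D : ℕ} {s : ι →₀ ℕ} :
    s ∈ Finset.univ.finsuppAntidiag D ↔ s.degree = D := by
  rw [Finset.mem_finsuppAntidiag, Finsupp.degree_eq_sum]
  simp only [Finset.subset_univ, and_true]

/-- Exponent vectors of a given degree form a finite type (via `finsuppAntidiag`). [folklore] -/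
noncomputable instance instFintypeExps (D : ℕ) : Fintype (Exps ι D) :=
  Fintype.subtype (Finset.univ.finsuppAntidiag D) fun _ => mem_finsuppAntidiag_univ_iff

/-- Column indices of the Sylvester matrix in degree `D`: pairs `(j, t)` with `t` an exponent
vector of degree `D - d j`, for the `j` with `d j ≤ D`. [folklore] -/
abbrev SylCols (ι : Type*) (d : Fin m → ℕ) (D : ℕ) : Type _ :=
  Σ j : {j : Fin m // d j ≤ D}, Exps ι (D - d j.1)

/-- The column indices of the Sylvester matrix form a finite type. [folklore] -/
noncomputable instance instFintypeSylCols (d : Fin m → ℕ) (D : ℕ) : Fintype (SylCols ι d D) :=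
  inferInstance

/-- **The Sylvester (multiplication) matrix in degree `D`** of a family `g j` of homogeneous
polynomials of degrees `d j`: rows are the monomials `X^s` of degree `D`, columns the pairs
`(j, X^t)` with `deg t = D - d j`, and the entry is the coefficient of `X^s` in `X^t · g j`.
Its columns span `k[X]_D` iff every monomial of degree `D` lies in the ideal `(g j)`.
[folklore] -/
noncomputable def sylvesterMatrix (g : Fin m → MvPolynomial ι k) (d : Fin m → ℕ) (D : ℕ) :
    Matrix (Exps ι D) (SylCols ι d D) k :=
  fun s c => coeff s.1 (monomial c.2.1 (1 : k) * g c.1.1)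

omit [Fintype ι] [DecidableEq ι] in
/-- The entries of the Sylvester matrix: `coeff_{s} (X^t g) = coeff_{s - t} g` if `t ≤ s`, else
`0`. [folklore] -/
theorem sylvesterMatrix_apply (g : Fin m → MvPolynomial ι k) (d : Fin m → ℕ) (D : ℕ)
    (s : Exps ι D) (c : SylCols ι d D) :
    sylvesterMatrix g d D s c = if c.2.1 ≤ s.1 then coeff (s.1 - c.2.1) (g c.1.1) else 0 := by
  rw [sylvesterMatrix, coeff_monomial_mul', one_mul]

/-- A homogeneous polynomial of degree `D` is the combination of the monomials of degree `D` with
its coefficients. [folklore] -/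
theorem eq_sum_coeff_monomial {p : MvPolynomial ι k} {D : ℕ} (hp : p.IsHomogeneous D) :
    p = ∑ s : Exps ι D, coeff s.1 p • monomial s.1 (1 : k) := by
  classical
  have hsub : p.support ⊆ Finset.univ.finsuppAntidiag D := fun s hs => by
    rw [mem_finsuppAntidiag_univ_iff, Finsupp.degree_eq_weight_one]
    exact hp (mem_support_iff.1 hs)
  calc p = ∑ s ∈ p.support, monomial s (coeff s p) := p.as_sum
    _ = ∑ s ∈ Finset.univ.finsuppAntidiag D, monomial s (coeff s p) :=
        Finset.sum_subset hsub fun s _ hns => by rw [MvPolynomial.notMem_support_iff.1 hns, monomial_zero]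
    _ = ∑ s : Exps ι D, monomial s.1 (coeff s.1 p) :=
        Finset.sum_subtype _ (fun s => mem_finsuppAntidiag_univ_iff) _
    _ = ∑ s : Exps ι D, coeff s.1 p • monomial s.1 (1 : k) :=
        Finset.sum_congr rfl fun s _ => by rw [smul_monomial, smul_eq_mul, mul_one]

/-- Two homogeneous polynomials of degree `D` with the same coefficients on the monomials of
degree `D` are equal. [folklore] -/
theorem eq_of_coeff_eq_of_isHomogeneous {p q : MvPolynomial ι k} {D : ℕ} (hp : p.IsHomogeneous D)
    (hq : q.IsHomogeneous D) (h : ∀ s : Exps ι D, coeff s.1 p = coeff s.1 q) : p = q := by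
  rw [eq_sum_coeff_monomial hp, eq_sum_coeff_monomial hq]
  exact Finset.sum_congr rfl fun s _ => by rw [h s]

/-- The polynomial `∑ v_{(j,t)} X^t g j` encoded by a column vector `v` of the Sylvester map.
[folklore] -/
noncomputable def sylCombination (g : Fin m → MvPolynomial ι k) (d : Fin m → ℕ) (D : ℕ)
    (v : SylCols ι d D → k) : MvPolynomial ι k :=
  ∑ c : SylCols ι d D, v c • (monomial c.2.1 (1 : k) * g c.1.1)

/-- `sylCombination` lies in the ideal `(g j)`. [folklore] -/
theorem sylCombination_mem (g : Fin m → MvPolynomial ι k) (d : Fin m → ℕ) (D : ℕ)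
    (v : SylCols ι d D → k) : sylCombination g d D v ∈ Ideal.span (Set.range g) := by
  refine Ideal.sum_mem _ fun c _ => ?_
  rw [smul_eq_C_mul, ← mul_assoc]
  exact Ideal.mul_mem_left _ _ (Ideal.subset_span ⟨c.1.1, rfl⟩)

/-- `sylCombination` is homogeneous of degree `D`. [folklore] -/
theorem isHomogeneous_sylCombination {g : Fin m → MvPolynomial ι k} {d : Fin m → ℕ}
    (hg : ∀ j, (g j).IsHomogeneous (d j)) (D : ℕ) (v : SylCols ι d D → k) :
    (sylCombination g d D v).IsHomogeneous D := by
  refine IsHomogeneous.sum _ _ _ fun c _ => ?_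
  rw [smul_eq_C_mul]
  have h1 : (monomial c.2.1 (1 : k) * g c.1.1).IsHomogeneous (D - d c.1.1 + d c.1.1) :=
    (isHomogeneous_monomial _ c.2.2).mul (hg c.1.1)
  rw [Nat.sub_add_cancel c.1.2] at h1
  exact h1.C_mul _

/-- The Sylvester map computes the coefficients of `sylCombination`. [folklore] -/
theorem sylvesterMatrix_mulVec (g : Fin m → MvPolynomial ι k) (d : Fin m → ℕ) (D : ℕ)
    (v : SylCols ι d D → k) (s : Exps ι D) :
    (sylvesterMatrix g d D).mulVec v s = coeff s.1 (sylCombination g d D v) := by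
  simp only [Matrix.mulVec, dotProduct, sylvesterMatrix, sylCombination, coeff_sum, coeff_smul,
    smul_eq_mul]
  exact Finset.sum_congr rfl fun c _ => mul_comm _ _

/-- **All monomials of degree `D` lie in `(g j)` iff the Sylvester map in degree `D` is
surjective.** [folklore] -/
theorem forall_monomial_mem_iff_surjective {g : Fin m → MvPolynomial ι k} {d : Fin m → ℕ}
    (hg : ∀ j, (g j).IsHomogeneous (d j)) (D : ℕ) :
    (∀ s : ι →₀ ℕ, s.degree = D → monomial s (1 : k) ∈ Ideal.span (Set.range g)) ↔
      Function.Surjective (sylvesterMatrix g d D).mulVec := by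
  classical
  constructor
  · intro h
    -- each unit vector `e_s` is hit: write `X^s = ∑ c j g j` with `c j` homogeneous
    have hunit : ∀ s : Exps ι D, ∃ v, (sylvesterMatrix g d D).mulVec v = Pi.single s 1 := by
      intro s
      obtain ⟨c, hchom, hczero, hcs⟩ :=
        exists_homogeneous_combination hg (isHomogeneous_monomial (1 : k) s.2) (h s.1 s.2)
      refine ⟨fun col => coeff col.2.1 (c col.1.1), funext fun s' => ?_⟩
      rw [sylvesterMatrix_mulVec]
      -- the combination is `∑ j, c j * g j = X^s`
      have hcomb : sylCombination g d D (fun col => coeff col.2.1 (c col.1.1)) = monomial s.1 1 := by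
        rw [sylCombination, hcs]
        have e1 : ∀ j : {j : Fin m // d j ≤ D},
            ∑ t : Exps ι (D - d j.1), coeff t.1 (c j.1) • (monomial t.1 (1 : k) * g j.1) =
              c j.1 * g j.1 := fun j => by
          conv_rhs => rw [eq_sum_coeff_monomial (hchom j.1), Finset.sum_mul]
          exact Finset.sum_congr rfl fun t _ => by rw [smul_mul_assoc]
        rw [Fintype.sum_sigma]
        simp_rw [e1]
        rw [← Fintype.sum_subtype_add_sum_subtype (fun j : Fin m => d j ≤ D) (fun j => c j * g j)]
        have e2 : ∑ j : {j : Fin m // ¬ d j ≤ D}, c j.1 * g j.1 = 0 :=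
          Finset.sum_eq_zero fun j _ => by rw [hczero j.1 (not_le.1 j.2), zero_mul]
        rw [e2, add_zero]
      rw [hcomb, coeff_monomial, Pi.single_apply]
      by_cases hss : s' = s
      · subst hss; simp
      · rw [if_neg (fun h' => hss (Subtype.ext h'.symm)), if_neg hss]
    choose v hv using hunit
    intro b
    refine ⟨∑ s, b s • v s, ?_⟩
    have hlin : (sylvesterMatrix g d D).mulVec (∑ s, b s • v s) =
        ∑ s, b s • (sylvesterMatrix g d D).mulVec (v s) := by
      rw [← Matrix.mulVecLin_apply, map_sum]
      exact Finset.sum_congr rfl fun s _ => by rw [map_smul, Matrix.mulVecLin_apply]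
    rw [hlin]
    simp_rw [hv]
    ext s
    simp [Finset.sum_apply, Pi.single_apply]
  · intro h s hs
    obtain ⟨v, hv⟩ := h (Pi.single ⟨s, hs⟩ 1)
    have heq : sylCombination g d D v = monomial s 1 := by
      refine eq_of_coeff_eq_of_isHomogeneous (isHomogeneous_sylCombination hg D v)
        (isHomogeneous_monomial (1 : k) hs) fun s' => ?_
      rw [← sylvesterMatrix_mulVec, hv, coeff_monomial, Pi.single_apply]
      by_cases hss : s' = ⟨s, hs⟩
      · subst hss; simp
      · rw [if_neg hss, if_neg (fun h' => hss (Subtype.ext h'.symm))]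
    rw [← heq]
    exact sylCombination_mem g d D v

end Sylvester

/-! ### Surjectivity of a matrix is the non-vanishing of a maximal minor -/

section Minors

variable {B C : Type*} [Fintype B] [DecidableEq B] [Fintype C] [DecidableEq C]

/-- **A matrix over a field is surjective iff some maximal minor is invertible**: `M : B × C`
defines a surjective `mulVec` iff for some choice `J : B → C` of columns the square submatrix
`M.submatrix id J` has non-zero determinant. [folklore] -/
theorem mulVec_surjective_iff_exists_det_ne_zero (M : Matrix B C k) :
    Function.Surjective M.mulVec ↔ ∃ J : B → C, (M.submatrix id J).det ≠ 0 := by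
  classical
  constructor
  · intro h
    -- the columns span; extract a basis among them
    have hspan : Submodule.span k (Set.range M.col) = ⊤ := by
      rw [← Matrix.range_mulVecLin, LinearMap.range_eq_top]
      intro b; obtain ⟨v, hv⟩ := h b; exact ⟨v, by rw [Matrix.mulVecLin_apply, hv]⟩
    obtain ⟨b, hbsub, hbspan, hbli⟩ := exists_linearIndependent k (Set.range M.col)
    rw [hspan] at hbspan
    haveI : Fintype b := (hbli.setFinite).fintype
    have hrange : Set.range ((↑) : b → B → k) = b := Subtype.range_coe
    let basis : Module.Basis b k (B → k) := Module.Basis.mk hbli (by rw [hrange, hbspan])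
    have hcard : Fintype.card b = Fintype.card B := by
      rw [← Module.finrank_eq_card_basis basis, Module.finrank_fintype_fun_eq_card]
    let e : B ≃ b := (Fintype.equivOfCardEq hcard).symm
    have hJ : ∀ i : B, ∃ j : C, M.col j = (e i : B → k) := fun i => by
      obtain ⟨j, hj⟩ := hbsub (e i).2
      exact ⟨j, hj⟩
    choose J hJ using hJ
    refine ⟨J, ?_⟩
    have hli : LinearIndependent k (M.submatrix id J).col := by
      have e1 : (M.submatrix id J).col = (fun i => (e i : B → k)) := by
        funext i; rw [← hJ i]; rfl
      rw [e1]
      exact hbli.comp e e.injective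
    have hunit := Matrix.linearIndependent_cols_iff_isUnit.1 hli
    rw [Matrix.isUnit_iff_isUnit_det, isUnit_iff_ne_zero] at hunit
    exact hunit
  · rintro ⟨J, hJ⟩ b
    set N := M.submatrix id J with hN
    have hNunit : IsUnit N := by rw [Matrix.isUnit_iff_isUnit_det, isUnit_iff_ne_zero]; exact hJ
    obtain ⟨c', hc'⟩ := (Matrix.mulVec_surjective_iff_isUnit.2 hNunit) b
    refine ⟨fun col => ∑ i : B, if J i = col then c' i else 0, ?_⟩
    rw [← hc']
    funext r
    simp only [Matrix.mulVec, dotProduct, hN, Matrix.submatrix_apply, id_eq, Finset.mul_sum]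
    rw [Finset.sum_comm]
    refine Finset.sum_congr rfl fun i _ => ?_
    simp only [mul_ite, mul_zero]
    rw [Finset.sum_ite_eq]
    simp

end Minors

/-! ### The elimination theorem -/

section Elimination

variable {σ : Type*} {m : ℕ}

attribute [local instance] zariskiTopologyPi

/-- The specialisation `f(y, ·) ∈ k[X]` of `f ∈ k[y][X]` at `y ∈ kᵐ`. [folklore] -/
noncomputable def specialize (y : σ → k) (f : MvPolynomial ι (MvPolynomial σ k)) : MvPolynomial ι k :=
  MvPolynomial.map (eval y) f

omit [Fintype ι] [DecidableEq ι] in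
/-- Specialisation preserves homogeneity in `X`. [folklore] -/
theorem isHomogeneous_specialize {f : MvPolynomial ι (MvPolynomial σ k)} {d : ℕ}
    (hf : f.IsHomogeneous d) (y : σ → k) : (specialize y f).IsHomogeneous d :=
  hf.map _

/-- The Sylvester matrix with entries in `k[y]` whose specialisations are the Sylvester matrices
of the specialised families. [folklore] -/
noncomputable def sylvesterMatrixPoly (f : Fin m → MvPolynomial ι (MvPolynomial σ k))
    (d : Fin m → ℕ) (D : ℕ) : Matrix (Exps ι D) (SylCols ι d D) (MvPolynomial σ k) :=
  fun s c => if c.2.1 ≤ s.1 then coeff (s.1 - c.2.1) (f c.1.1) else 0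

omit [Fintype ι] [DecidableEq ι] in
/-- **The entries of the Sylvester matrix are polynomial in the parameters.** [folklore] -/
theorem sylvesterMatrix_specialize (f : Fin m → MvPolynomial ι (MvPolynomial σ k))
    (d : Fin m → ℕ) (D : ℕ) (y : σ → k) :
    sylvesterMatrix (fun j => specialize y (f j)) d D = (sylvesterMatrixPoly f d D).map (eval y) := by
  ext s c
  rw [sylvesterMatrix_apply, Matrix.map_apply, sylvesterMatrixPoly]
  split_ifs with h
  · rw [specialize, coeff_map]
  · rw [map_zero]

variable [IsAlgClosed k]

/-- **The main theorem of elimination theory on `k`-points** (Springer 6.1.1–6.1.3: projective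
space is complete, i.e. `ℙⁿ × kᵐ → kᵐ` is closed): for a finite family `f j ∈ k[y][X]`
homogeneous of degree `d j` in the variables `X` (indexed by the finite type `ι`) over an
algebraically closed field, the set of parameters `y ∈ kᵐ` at which the `f j (y, ·)` have a
common zero `x ≠ 0` is Zariski closed. It is the intersection over `D` of the loci where the
Sylvester map in degree `D` is not surjective (projective Nullstellensatz
`exists_ne_zero_common_zero_iff` and `forall_monomial_mem_iff_surjective`), i.e. where all its
maximal minors — polynomials in `y` — vanish (`mulVec_surjective_iff_exists_det_ne_zero`).
[cite: SpringerLAG1998, 6.1.3] -/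
theorem isClosed_setOf_exists_common_zero (f : Fin m → MvPolynomial ι (MvPolynomial σ k))
    {d : Fin m → ℕ} (hf : ∀ j, (f j).IsHomogeneous (d j)) :
    IsClosed {y : σ → k | ∃ x : ι → k, x ≠ 0 ∧ ∀ j, eval x (specialize y (f j)) = 0} := by
  classical
  have e : {y : σ → k | ∃ x : ι → k, x ≠ 0 ∧ ∀ j, eval x (specialize y (f j)) = 0} =
      ⋂ D : ℕ, ⋂ J : Exps ι D → SylCols ι d D,
        {y | eval y ((sylvesterMatrixPoly f d D).submatrix id J).det = 0} := by
    ext y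
    simp only [Set.mem_setOf_eq, Set.mem_iInter]
    rw [exists_ne_zero_common_zero_iff]
    refine forall_congr' fun D => ?_
    rw [forall_monomial_mem_iff_surjective (fun j => isHomogeneous_specialize (hf j) y) D,
      mulVec_surjective_iff_exists_det_ne_zero, not_exists]
    refine forall_congr' fun J => ?_
    rw [not_ne_iff, sylvesterMatrix_specialize, Matrix.submatrix_map, ← RingHom.mapMatrix_apply,
      ← RingHom.map_det]
  rw [e]
  exact isClosed_iInter fun D => isClosed_iInter fun J => isClosed_setOf_eval_eq_zero _

end Elimination

end Literature.NumberTheory.Automorphic
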